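import Summits.HodgeConjecture.CorCM.GaloisTransversalCompositum
import Summits.HodgeConjecture.CorCM.AdmissibleHalvesIndexTwo
import Summits.HodgeConjecture.CorCM.InvolutionsOutsideSubgroups
import Summits.HodgeConjecture.CorCM.GaloisCosetIntervalTypes
import HarnessLib

/-!
# A totally real Galois factor is fatal: `K = M · L` is BAD for every `Gal(M/ℚ) ∉ {1, C₂, C₄, C₂², C₂³, C_p, S₃}`

COR-CM (cell `pub-hodgecm2`), binder seat b04 (gen 24), count-neutral claim REAL-FACTOR, part III (NAME ACK + blanket
`CorCM/GaloisRealFactor*`, HOME/INBOX l.10153).  HC_CM is NOT proved here; unconditional negative-side theorems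
(simple CM abelian varieties whose powers carry exceptional Hodge classes).  KERNEL ONLY: theorems; no definition, no
named fact, no `sorry`.

Setting: `Gal(K/ℚ) ≅ H × Γ` with complex conjugation `(1, c₁)` — `K = M · L` with `M = K^Γ` TOTALLY REAL Galois
of group `H` and `L = K^H` a Galois CM field of group `Γ` (complex conjugation `c₁`), linearly disjoint — and
`F ⊆ Γ` a PRIMITIVE CM type of `L`.

**Theorem (`exists_simple_degenerate_of_real_factor`).**  Unless `H` has exponent `≤ 2` and order `≤ 8`, or order
`4`, or prime order, or order `6` and is non-abelian — i.e. unless `H ∈ {1, C₂, C₂², C₂³, C₄, C_p, S₃}` — the field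
`K` carries a SIMPLE DEGENERATE abelian variety of dimension `[K:ℚ]/2 = |H||Γ|/2` with CM by `K`.  Clean forms:
`|H| ≥ 9` not prime (`…_card_ge_nine`); `|H| = 8` with an element of order `> 2` (`…_card_eq_eight`); `|H| = 6`
abelian (`…_card_eq_six`).  For `Γ = C₂` (`L` imaginary quadratic) this is the bad side of gen 19's classification
(`TwiceOdd.forall_isSimple_isNondegenerate_iff_of_quadratic`), whose GOOD list is exactly the excluded one; here
`Γ` and `F` are arbitrary (for the excluded `H` the answer depends on `L`: `C₃ × C₄ = C₁₂` and `Q₈ × C₂` are GOOD,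
`C₄ × C₄`, `Q₈ × C₄`, `Q₈ × C₂²` are BAD — gens 12, 15, 20, 23).

Proof.  If some subgroup `V ≤ H` with `3 ≤ |V|` has a non-involution outside it: part II, the TRANSVERSAL type
(`exists_simple_degenerate_of_model_transversal`).  Otherwise gen 19 part VIII
(`TwiceOdd.dihedral_or_of_forall_mul_self_eq_one`): `H` has exponent `2` — then `|H| ≥ 16` and part I gives an
ADMISSIBLE HALF (`AdmissibleHalves.exists_half_of_exponent_two`) for gen 23's TWO-FIBRE type
(`exists_simple_degenerate_of_model_twoFibre`) —, or `|H| = 4`, or `|H|` is prime (excluded), or `H ≅ D_p`: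
`p = 3` is excluded and `p ≥ 5` has an admissible half (`AdmissibleHalves.exists_half_of_orderOf`).

Instances (§3): `H × Q_{4n}` (`exists_simple_degenerate_of_quaternion_compositum_card_ge_nine`, dim `2n|H|`) and
`H × C_{2h}`, `h ≥ 2` (`exists_simple_degenerate_of_cyclic_compositum_card_ge_nine`, dim `h|H|`; the primitive type
of a cyclic CM field is the interval, gen 23 `GaloisCosetInterval` with `U = 1`) for every `H` of composite order
`≥ 9` — e.g. `C₉`, `C₃ × C₃`, `A₄`, `C₁₅`, every group of order `16`, `S₄`, `A₅`, … (odd orders included: no half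
is needed).

References: Shimura (1998), §6.2 Thm. 3, §8.2 Prop. 26 [cite: Shimura1998]; Gordon (1999), Thm. 6.4, §9.3
[cite: Gordon1999HodgeAVSurvey]; Dodson (1984), §3.1.1, §4.1 [cite: Dodson1984].
-/

noncomputable section

open CategoryTheory CategoryTheory.Limits NumberField
open scoped BigOperators

namespace Summit.HodgeConjecture.CorCM.GaloisModels

open Literature.NumberTheory.ComplexMultiplication
open Literature.AlgebraicGeometry.Motives (AbelianVariety CMType)
open Literature.AlgebraicGeometry.HodgeTheory
open Literature.AlgebraicGeometry.ComplexMultiplication (IsCMTypeRealisation)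
open Literature.AlgebraicGeometry.Pohlmann1968
open Literature.Barriers.HodgeConjecture (divisorClassesSpan)
open Summit.HodgeConjecture.CorCM.TwiceOdd (dihedral_or_of_forall_mul_self_eq_one)
open Summit.HodgeConjecture.CorCM.AdmissibleHalves (exists_half_of_exponent_two exists_half_of_orderOf)

section RealFactor

variable {H Γ : Type*} [Group H] [Fintype H] [DecidableEq H] [Group Γ] [Fintype Γ] [DecidableEq Γ]
variable {K : Type} [Field K] [NumberField K] [IsCMField K] [IsGalois ℚ K]

omit [DecidableEq H] in
/-- A finite group of exponent `2` has order a power of `2`. [folklore] -/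
theorem exists_card_eq_two_pow_of_exponent_two (hexp : ∀ h : H, h * h = 1) : ∃ j : ℕ, Fintype.card H = 2 ^ j := by
  haveI : Fact (Nat.Prime 2) := ⟨Nat.prime_two⟩
  have hPG : IsPGroup 2 H := fun g => ⟨1, by rw [pow_one, pow_two, hexp]⟩
  obtain ⟨j, hj⟩ := IsPGroup.iff_card.1 hPG
  exact ⟨j, by rw [← Nat.card_eq_fintype_card, hj]⟩

/-! ## §1 The theorem -/

/-- **A TOTALLY REAL GALOIS FACTOR IS FATAL.**  `Gal(K/ℚ) ≅ H × Γ`, `c = (1, c₁)`, `F ⊆ Γ` a primitive CM set of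
`(Γ, c₁)`.  If `H` is not of exponent `≤ 2` with `|H| ≤ 8`, `|H| ≠ 4`, `|H|` is not prime, and `H` is abelian if
`|H| = 6` — i.e. `H ∉ {1, C₂, C₂², C₂³, C₄, C_p, S₃}` — then `K` carries a SIMPLE DEGENERATE abelian variety of
dimension `|H||Γ|/2` with CM by `K`, with a rational `(p,p)` class outside the divisor ring on some power.
[cite: Shimura1998, §6.2 Thm. 3 and §8.2 Prop. 26] [cite: Gordon1999HodgeAVSurvey, Thm. 6.4 and §9.3]
[cite: Dodson1984, §3.1.1 and §4.1] -/
theorem exists_simple_degenerate_of_real_factor (e : (K ≃ₐ[ℚ] K) ≃* H × Γ) (c₁ : Γ)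
    (hc : e ((IsCMField.complexConj K).restrictScalars ℚ) = (1, c₁)) (F : Finset Γ)
    (hFcm : ∀ v, v ∈ F ↔ c₁ * v ∉ F) (hFprim : ∀ b : Γ, b ≠ 1 → ∃ v, ¬ (v ∈ F ↔ b * v ∈ F))
    (hexp : (∀ h : H, h * h = 1) → 8 < Fintype.card H) (h4 : Fintype.card H ≠ 4)
    (hprime : ¬ (Fintype.card H).Prime) (h6 : Fintype.card H = 6 → ∀ a b : H, a * b = b * a) :
    ∃ (Φ : CMType K) (φ₀ : K →+* ℂ) (A : AbelianVariety ℂ) (ι : 𝓞 K →+* End A)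
      (θ : K →+* Module.End ℂ (complexBetti A.X 1)),
      IsPrimitive (ℂ ≃+* ℂ) Φ.1 φ₀ ∧ ¬ IsNondegenerate Φ ∧ IsCMTypeRealisation Φ A ι θ ∧ A.IsSimple ∧
      A.dim = Fintype.card H * Fintype.card Γ / 2 ∧
      ∃ n p : ℕ, ∃ x : complexBetti (⨁ fun _ : Fin n => A).X (2 * p), IsRationalClass x ∧
        IsOfHodgeType (⨁ fun _ : Fin n => A).dim (⨁ fun _ : Fin n => A).X (2 * p) p p x ∧
        x ∉ divisorClassesSpan (⨁ fun _ : Fin n => A).X (⨁ fun _ : Fin n => A).dim p := by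
  classical
  by_cases hV : ∃ V : Subgroup H, 3 ≤ Nat.card V ∧ ∃ y, y ∉ V ∧ y * y ≠ 1
  · obtain ⟨V, h3, y₀, hy₀V, hy₀2⟩ := hV
    exact exists_simple_degenerate_of_model_transversal e c₁ hc F hFcm hFprim V h3 hy₀V hy₀2
  have hyp : ∀ V : Subgroup H, V ≤ ⊤ → 3 ≤ Nat.card V → V ≠ ⊤ →
      ∀ y ∈ (⊤ : Subgroup H), y ∉ V → y * y = 1 := by
    intro V _ h3 _ y _ hyV
    by_contra hyy
    exact hV ⟨V, h3, y, hyV, hyy⟩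
  have hcardtop : Nat.card (⊤ : Subgroup H) = Fintype.card H := by
    rw [Subgroup.card_top, Nat.card_eq_fintype_card]
  rcases dihedral_or_of_forall_mul_self_eq_one hyp with hA | hB | hC |
      ⟨r, -, s, -, p, hp, hp3, hord, -, -, hsrs, h2p⟩
  · -- (A) exponent `2`: then `|H| = 2^j > 8`, so `|H| ≥ 16` and an index-`2` subgroup gives an admissible half
    have hexp' : ∀ h : H, h * h = 1 := fun h => hA h (Subgroup.mem_top h)
    have h16 : 16 ≤ Fintype.card H := by
      obtain ⟨j, hj⟩ := exists_card_eq_two_pow_of_exponent_two hexp'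
      have h8 := hexp hexp'
      rw [hj] at h8 ⊢
      have hj4 : 4 ≤ j := by
        by_contra hlt
        have : 2 ^ j ≤ 2 ^ 3 := Nat.pow_le_pow_right (by norm_num) (by omega)
        omega
      exact le_trans (by norm_num) (Nat.pow_le_pow_right (by norm_num) hj4 : 2 ^ 4 ≤ 2 ^ j)
    obtain ⟨A, hAcard, hAprim, hAcomp⟩ := exists_half_of_exponent_two hexp' h16
    exact exists_simple_degenerate_of_model_twoFibre e c₁ hc F hFcm hFprim A hAcard hAprim hAcomp
  · -- (B) `|H| = 4`: excluded
    rw [hcardtop] at hB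
    exact absurd hB h4
  · -- (C) `|H|` prime: excluded
    rw [hcardtop] at hC
    exact absurd hC hprime
  · -- (D) dihedral of order `2p`
    rw [hcardtop] at h2p
    by_cases hp5 : 5 ≤ p
    · obtain ⟨A, hAcard, hAprim, hAcomp⟩ := exists_half_of_orderOf hord hp5 h2p
      exact exists_simple_degenerate_of_model_twoFibre e c₁ hc F hFcm hFprim A hAcard hAprim hAcomp
    · -- `p = 3`: `|H| = 6` and `s r s⁻¹ = r⁻¹ ≠ r`, so `H` is non-abelian: excluded
      exfalso
      have hp3' : p = 3 := by
        rcases (show p = 3 ∨ p = 4 by omega) with h | h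
        · exact h
        · exact absurd (h ▸ hp) (by decide)
      subst hp3'
      have hcomm := h6 (by rw [h2p]) s r
      have hr : r⁻¹ = r := by rw [← hsrs, hcomm, mul_inv_cancel_right]
      have hr2 : r ^ 2 = 1 := by
        rw [pow_two]
        nth_rewrite 1 [← hr]
        exact inv_mul_cancel r
      have h32 : 3 ∣ 2 := by rw [← hord]; exact orderOf_dvd_of_pow_eq_one hr2
      omega

/-! ## §2 Clean forms -/

/-- **`|H| ≥ 9` composite** — every totally real Galois field `M` of composite degree `≥ 9` — times ANY linearly
disjoint Galois CM field `L` with a primitive CM type: `K = M·L` carries a simple DEGENERATE CM abelian variety of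
dimension `[K:ℚ]/2`. [cite: Shimura1998, §6.2 Thm. 3 and §8.2 Prop. 26] [cite: Gordon1999HodgeAVSurvey, Thm. 6.4]
[cite: Dodson1984, §3.1.1] -/
theorem exists_simple_degenerate_of_real_factor_card_ge_nine (e : (K ≃ₐ[ℚ] K) ≃* H × Γ) (c₁ : Γ)
    (hc : e ((IsCMField.complexConj K).restrictScalars ℚ) = (1, c₁)) (F : Finset Γ)
    (hFcm : ∀ v, v ∈ F ↔ c₁ * v ∉ F) (hFprim : ∀ b : Γ, b ≠ 1 → ∃ v, ¬ (v ∈ F ↔ b * v ∈ F))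
    (h9 : 9 ≤ Fintype.card H) (hprime : ¬ (Fintype.card H).Prime) :
    ∃ (Φ : CMType K) (φ₀ : K →+* ℂ) (A : AbelianVariety ℂ) (ι : 𝓞 K →+* End A)
      (θ : K →+* Module.End ℂ (complexBetti A.X 1)),
      IsPrimitive (ℂ ≃+* ℂ) Φ.1 φ₀ ∧ ¬ IsNondegenerate Φ ∧ IsCMTypeRealisation Φ A ι θ ∧ A.IsSimple ∧
      A.dim = Fintype.card H * Fintype.card Γ / 2 ∧
      ∃ n p : ℕ, ∃ x : complexBetti (⨁ fun _ : Fin n => A).X (2 * p), IsRationalClass x ∧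
        IsOfHodgeType (⨁ fun _ : Fin n => A).dim (⨁ fun _ : Fin n => A).X (2 * p) p p x ∧
        x ∉ divisorClassesSpan (⨁ fun _ : Fin n => A).X (⨁ fun _ : Fin n => A).dim p :=
  exists_simple_degenerate_of_real_factor e c₁ hc F hFcm hFprim (fun _ => by omega) (by omega) hprime
    (fun h => absurd h (by omega))

/-- **`|H| = 8` with an element of order `> 2`** (`C₈`, `C₄ × C₂`, `D₄`, `Q₈`; not `C₂³`): `K = M·L` is BAD for
every `L` with a primitive CM type. [cite: Shimura1998, §6.2 Thm. 3 and §8.2 Prop. 26]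
[cite: Gordon1999HodgeAVSurvey, Thm. 6.4] -/
theorem exists_simple_degenerate_of_real_factor_card_eq_eight (e : (K ≃ₐ[ℚ] K) ≃* H × Γ) (c₁ : Γ)
    (hc : e ((IsCMField.complexConj K).restrictScalars ℚ) = (1, c₁)) (F : Finset Γ)
    (hFcm : ∀ v, v ∈ F ↔ c₁ * v ∉ F) (hFprim : ∀ b : Γ, b ≠ 1 → ∃ v, ¬ (v ∈ F ↔ b * v ∈ F))
    (h8 : Fintype.card H = 8) {g : H} (hg : g * g ≠ 1) :
    ∃ (Φ : CMType K) (φ₀ : K →+* ℂ) (A : AbelianVariety ℂ) (ι : 𝓞 K →+* End A)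
      (θ : K →+* Module.End ℂ (complexBetti A.X 1)),
      IsPrimitive (ℂ ≃+* ℂ) Φ.1 φ₀ ∧ ¬ IsNondegenerate Φ ∧ IsCMTypeRealisation Φ A ι θ ∧ A.IsSimple ∧
      A.dim = Fintype.card H * Fintype.card Γ / 2 ∧
      ∃ n p : ℕ, ∃ x : complexBetti (⨁ fun _ : Fin n => A).X (2 * p), IsRationalClass x ∧
        IsOfHodgeType (⨁ fun _ : Fin n => A).dim (⨁ fun _ : Fin n => A).X (2 * p) p p x ∧
        x ∉ divisorClassesSpan (⨁ fun _ : Fin n => A).X (⨁ fun _ : Fin n => A).dim p :=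
  exists_simple_degenerate_of_real_factor e c₁ hc F hFcm hFprim (fun h => absurd (h g) hg) (by omega)
    (by rw [h8]; decide) (fun h => absurd h (by omega))

/-- **`|H| = 6` abelian** (`C₆`, a real cyclic sextic `M`): `K = M·L` is BAD for every `L` with a primitive CM type.
[cite: Shimura1998, §6.2 Thm. 3 and §8.2 Prop. 26] [cite: Gordon1999HodgeAVSurvey, Thm. 6.4] -/
theorem exists_simple_degenerate_of_real_factor_card_eq_six (e : (K ≃ₐ[ℚ] K) ≃* H × Γ) (c₁ : Γ)
    (hc : e ((IsCMField.complexConj K).restrictScalars ℚ) = (1, c₁)) (F : Finset Γ)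
    (hFcm : ∀ v, v ∈ F ↔ c₁ * v ∉ F) (hFprim : ∀ b : Γ, b ≠ 1 → ∃ v, ¬ (v ∈ F ↔ b * v ∈ F))
    (h6 : Fintype.card H = 6) (hcomm : ∀ a b : H, a * b = b * a) :
    ∃ (Φ : CMType K) (φ₀ : K →+* ℂ) (A : AbelianVariety ℂ) (ι : 𝓞 K →+* End A)
      (θ : K →+* Module.End ℂ (complexBetti A.X 1)),
      IsPrimitive (ℂ ≃+* ℂ) Φ.1 φ₀ ∧ ¬ IsNondegenerate Φ ∧ IsCMTypeRealisation Φ A ι θ ∧ A.IsSimple ∧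
      A.dim = Fintype.card H * Fintype.card Γ / 2 ∧
      ∃ n p : ℕ, ∃ x : complexBetti (⨁ fun _ : Fin n => A).X (2 * p), IsRationalClass x ∧
        IsOfHodgeType (⨁ fun _ : Fin n => A).dim (⨁ fun _ : Fin n => A).X (2 * p) p p x ∧
        x ∉ divisorClassesSpan (⨁ fun _ : Fin n => A).X (⨁ fun _ : Fin n => A).dim p := by
  refine exists_simple_degenerate_of_real_factor e c₁ hc F hFcm hFprim (fun hexp => ?_) (by omega)
    (by rw [h6]; decide) (fun _ => hcomm)
  exfalso
  obtain ⟨j, hj⟩ := exists_card_eq_two_pow_of_exponent_two hexp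
  have h3 : 3 ∣ 2 ^ j := ⟨2, by omega⟩
  have := Nat.le_of_dvd two_pos (Nat.Prime.dvd_of_dvd_pow Nat.prime_three h3)
  omega

/-! ## §3 Instances: `L` a `Q_{4n}`-CM field or a cyclic CM field -/

open QuaternionGroup in
/-- **`Gal(K/ℚ) ≅ H × Q_{4n}` (`n ≥ 1`, `c = (1, aⁿ)`) with `|H| ≥ 9` composite ⟹ a simple DEGENERATE abelian
variety of dimension `2n|H|` with CM by `K`** (two-fibre or transversal type over the quaternionic double interval).
[cite: Shimura1998, §6.2 Thm. 3 and §8.2 Prop. 26] [cite: Gordon1999HodgeAVSurvey, Thm. 6.4] -/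
theorem exists_simple_degenerate_of_quaternion_compositum_card_ge_nine {n : ℕ} (h1 : 1 ≤ n)
    (e : (K ≃ₐ[ℚ] K) ≃* H × QuaternionGroup n)
    (hc : e ((IsCMField.complexConj K).restrictScalars ℚ) = (1, a n))
    (h9 : 9 ≤ Fintype.card H) (hprime : ¬ (Fintype.card H).Prime) :
    ∃ (Φ : CMType K) (φ₀ : K →+* ℂ) (A : AbelianVariety ℂ) (ι : 𝓞 K →+* End A)
      (θ : K →+* Module.End ℂ (complexBetti A.X 1)),
      IsPrimitive (ℂ ≃+* ℂ) Φ.1 φ₀ ∧ ¬ IsNondegenerate Φ ∧ IsCMTypeRealisation Φ A ι θ ∧ A.IsSimple ∧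
      A.dim = 2 * n * Fintype.card H ∧
      ∃ n p : ℕ, ∃ x : complexBetti (⨁ fun _ : Fin n => A).X (2 * p), IsRationalClass x ∧
        IsOfHodgeType (⨁ fun _ : Fin n => A).dim (⨁ fun _ : Fin n => A).X (2 * p) p p x ∧
        x ∉ divisorClassesSpan (⨁ fun _ : Fin n => A).X (⨁ fun _ : Fin n => A).dim p := by
  classical
  haveI : NeZero n := ⟨by omega⟩
  obtain ⟨Ψ₀, hA, hX⟩ := exists_quaternionDoubleInterval (n := n)
  have hmain := exists_simple_degenerate_of_real_factor_card_ge_nine e (a n) hc Ψ₀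
    (quaternion_doubleInterval_cm hA hX) (quaternion_doubleInterval_leftStabiliser hA hX) h9 hprime
  rwa [QuaternionGroup.card, show Fintype.card H * (4 * n) / 2 = 2 * n * Fintype.card H by
    rw [show Fintype.card H * (4 * n) = 2 * n * Fintype.card H * 2 by ring, Nat.mul_div_cancel _ two_pos]]
    at hmain

omit [DecidableEq Γ] in
/-- **The interval of a cyclic group is a primitive CM set**: `Γ` of order `2h ≥ 4` with an element `α` of order
`2h` has a CM set for `α^h` with trivial left stabiliser (gen 23 `GaloisCosetInterval` with `U = 1`: the interval
`{αˣ : x < h}`). [cite: Shimura1998, §8.2 Prop. 26 and §18.2 Lemma (i)] -/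
theorem exists_primitive_cm_of_cyclic {α : Γ} {h : ℕ} (h2 : 2 ≤ h) (hord : orderOf α = 2 * h)
    (hΓ : Fintype.card Γ = 2 * h) :
    ∃ F : Finset Γ, (∀ v, v ∈ F ↔ α ^ h * v ∉ F) ∧ (∀ b : Γ, b ≠ 1 → ∃ v, ¬ (v ∈ F ↔ b * v ∈ F)) := by
  classical
  haveI : NeZero h := ⟨by omega⟩
  have hAU : ∀ w ∈ (⊥ : Subgroup Γ), w ∈ Subgroup.zpowers α → w = 1 := fun w hw _ => Subgroup.mem_bot.1 hw
  have hcard' : Fintype.card Γ = 2 * h * Nat.card (⊥ : Subgroup Γ) := by rw [Subgroup.card_bot, mul_one, hΓ]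
  obtain ⟨T, hT⟩ := GaloisCosetInterval.exists_cosetInterval (U := ⊥) hord hAU
  refine ⟨T, GaloisCosetInterval.cosetInterval_cm hord hAU hcard' hT, fun b hb =>
    GaloisCosetInterval.cosetInterval_leftStabiliser h2 hord hAU hcard' (fun w hw => ⟨1, ?_⟩)
      (fun w hw _ => Subgroup.mem_bot.1 hw) (fun w hw => ?_) hT b hb⟩
  · rw [Subgroup.mem_bot.1 hw, pow_one, one_mul, mul_one]
  · rw [Subgroup.mem_bot.1 hw, one_mul, inv_one, mul_one]
    intro hαα
    have hsq : α ^ 2 = 1 := by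
      rw [pow_two]
      nth_rewrite 2 [hαα]
      exact mul_inv_cancel α
    have hd := orderOf_dvd_of_pow_eq_one hsq
    rw [hord] at hd
    have := Nat.le_of_dvd two_pos hd
    omega

/-- **`Gal(K/ℚ) ≅ H × C_{2h}` (`h ≥ 2`, `c = (1, α^h)` for a generator `α`) with `|H| ≥ 9` composite ⟹ a simple
DEGENERATE abelian variety of dimension `h|H|` with CM by `K`** — a totally real Galois field of composite degree
`≥ 9` times a linearly disjoint CYCLIC CM field of degree `≥ 4` (for `Γ = C₂` see gen 19
`TwiceOdd.exists_simple_degenerate_of_quadratic`). [cite: Shimura1998, §6.2 Thm. 3 and §8.2 Prop. 26]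
[cite: Gordon1999HodgeAVSurvey, Thm. 6.4] -/
theorem exists_simple_degenerate_of_cyclic_compositum_card_ge_nine {α : Γ} {h : ℕ} (h2 : 2 ≤ h)
    (hord : orderOf α = 2 * h) (hΓ : Fintype.card Γ = 2 * h) (e : (K ≃ₐ[ℚ] K) ≃* H × Γ)
    (hc : e ((IsCMField.complexConj K).restrictScalars ℚ) = (1, α ^ h))
    (h9 : 9 ≤ Fintype.card H) (hprime : ¬ (Fintype.card H).Prime) :
    ∃ (Φ : CMType K) (φ₀ : K →+* ℂ) (A : AbelianVariety ℂ) (ι : 𝓞 K →+* End A)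
      (θ : K →+* Module.End ℂ (complexBetti A.X 1)),
      IsPrimitive (ℂ ≃+* ℂ) Φ.1 φ₀ ∧ ¬ IsNondegenerate Φ ∧ IsCMTypeRealisation Φ A ι θ ∧ A.IsSimple ∧
      A.dim = h * Fintype.card H ∧
      ∃ n p : ℕ, ∃ x : complexBetti (⨁ fun _ : Fin n => A).X (2 * p), IsRationalClass x ∧
        IsOfHodgeType (⨁ fun _ : Fin n => A).dim (⨁ fun _ : Fin n => A).X (2 * p) p p x ∧
        x ∉ divisorClassesSpan (⨁ fun _ : Fin n => A).X (⨁ fun _ : Fin n => A).dim p := by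
  obtain ⟨F, hFcm, hFprim⟩ := exists_primitive_cm_of_cyclic h2 hord hΓ
  have hmain := exists_simple_degenerate_of_real_factor_card_ge_nine e (α ^ h) hc F hFcm hFprim h9 hprime
  rwa [hΓ, show Fintype.card H * (2 * h) / 2 = h * Fintype.card H by
    rw [show Fintype.card H * (2 * h) = h * Fintype.card H * 2 by ring, Nat.mul_div_cancel _ two_pos]] at hmain

/-! ## §4 Central twist: when `M` is a CM field too -/

omit [Fintype H] [DecidableEq H] [Fintype Γ] [DecidableEq Γ] in
/-- **Central twist.**  If `e : G ≃* H × Γ` sends `c` to `(c₀, c₁)` and `ψ : Γ →* H` is a homomorphism into the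
centre of `H` with `ψ c₁ = c₀` (e.g. `Γ = C₂`; or `Γ` cyclic of order `2k`, `k` odd, `c₀` central of order `≤ 2`),
then composing `e` with the automorphism `(h, γ) ↦ (h ψ(γ)⁻¹, γ)` of `H × Γ` gives `e'` with `e' c = (1, c₁)`: a
compositum `K = M · L` of TWO Galois CM fields is then also `M' · L` with `M' = K^{e'⁻¹(1 × Γ)}` totally real of group
`H`, and the theorems above apply. [folklore] -/
theorem exists_mulEquiv_prod_centralTwist {G : Type*} [Group G] (e : G ≃* H × Γ) {c : G} {c₀ : H} {c₁ : Γ}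
    (hc : e c = (c₀, c₁)) (ψ : Γ →* H) (hψ : ∀ γ h, ψ γ * h = h * ψ γ) (hψc : ψ c₁ = c₀) :
    ∃ e' : G ≃* H × Γ, e' c = (1, c₁) := by
  have hψ' : ∀ γ (h : H), (ψ γ)⁻¹ * h = h * (ψ γ)⁻¹ := fun γ h => by
    rw [← map_inv]; exact hψ γ⁻¹ h
  let θ : H × Γ ≃* H × Γ :=
    { toFun := fun x => (x.1 * (ψ x.2)⁻¹, x.2)
      invFun := fun x => (x.1 * ψ x.2, x.2)
      left_inv := fun x => by simp
      right_inv := fun x => by simp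
      map_mul' := fun x y => by
        refine Prod.ext ?_ rfl
        change x.1 * y.1 * (ψ (x.2 * y.2))⁻¹ = x.1 * (ψ x.2)⁻¹ * (y.1 * (ψ y.2)⁻¹)
        rw [map_mul, mul_inv_rev]
        simp only [mul_assoc]
        rw [← mul_assoc (ψ x.2)⁻¹ y.1, hψ' x.2 y.1, mul_assoc, hψ' x.2 (ψ y.2)⁻¹] }
  refine ⟨e.trans θ, ?_⟩
  rw [MulEquiv.trans_apply, hc]
  change (c₀ * (ψ c₁)⁻¹, c₁) = (1, c₁)
  rw [hψc, mul_inv_cancel]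

/-- **`K = M · L` with `M` CM as well**: `Gal(K/ℚ) ≅ H × Γ`, `c ↦ (c₀, c₁)`, a central homomorphism `ψ : Γ → Z(H)`
with `ψ c₁ = c₀`, `F ⊆ Γ` a primitive CM set of `(Γ, c₁)` and `H ∉ {1, C₂, C₂², C₂³, C₄, C_p, S₃}` (as in
`exists_simple_degenerate_of_real_factor`) ⟹ a simple DEGENERATE abelian variety of dimension `|H||Γ|/2` with CM by
`K`. [cite: Shimura1998, §6.2 Thm. 3 and §8.2 Prop. 26] [cite: Gordon1999HodgeAVSurvey, Thm. 6.4] -/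
theorem exists_simple_degenerate_of_real_factor_twist (e : (K ≃ₐ[ℚ] K) ≃* H × Γ) (c₀ : H) (c₁ : Γ)
    (hc : e ((IsCMField.complexConj K).restrictScalars ℚ) = (c₀, c₁)) (ψ : Γ →* H)
    (hψ : ∀ γ h, ψ γ * h = h * ψ γ) (hψc : ψ c₁ = c₀) (F : Finset Γ)
    (hFcm : ∀ v, v ∈ F ↔ c₁ * v ∉ F) (hFprim : ∀ b : Γ, b ≠ 1 → ∃ v, ¬ (v ∈ F ↔ b * v ∈ F))
    (hexp : (∀ h : H, h * h = 1) → 8 < Fintype.card H) (h4 : Fintype.card H ≠ 4)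
    (hprime : ¬ (Fintype.card H).Prime) (h6 : Fintype.card H = 6 → ∀ a b : H, a * b = b * a) :
    ∃ (Φ : CMType K) (φ₀ : K →+* ℂ) (A : AbelianVariety ℂ) (ι : 𝓞 K →+* End A)
      (θ : K →+* Module.End ℂ (complexBetti A.X 1)),
      IsPrimitive (ℂ ≃+* ℂ) Φ.1 φ₀ ∧ ¬ IsNondegenerate Φ ∧ IsCMTypeRealisation Φ A ι θ ∧ A.IsSimple ∧
      A.dim = Fintype.card H * Fintype.card Γ / 2 ∧
      ∃ n p : ℕ, ∃ x : complexBetti (⨁ fun _ : Fin n => A).X (2 * p), IsRationalClass x ∧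
        IsOfHodgeType (⨁ fun _ : Fin n => A).dim (⨁ fun _ : Fin n => A).X (2 * p) p p x ∧
        x ∉ divisorClassesSpan (⨁ fun _ : Fin n => A).X (⨁ fun _ : Fin n => A).dim p := by
  obtain ⟨e', hc'⟩ := exists_mulEquiv_prod_centralTwist e hc ψ hψ hψc
  exact exists_simple_degenerate_of_real_factor e' c₁ hc' F hFcm hFprim hexp h4 hprime h6

end RealFactor

end Summit.HodgeConjecture.CorCM.GaloisModels

end
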